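import Literature.MathematicalPhysics.QuantumFieldTheory.Balaban1983to89.B9Eq3132TentPlaquettes

/-!
# `Balaban1983to89.B9Eq3132KnitTentRebase` — T. Bałaban, *Propagators and renormalization transformations for lattice gauge theories. II*, Commun. Math. Phys.
# **96** (1984) 223–250 [Balaban1984PropagatorsII], (2.147) p. 248 with [Balaban1985BackgroundPropagators] (3.13) p. 393, (3.115) p. 418, (3.132) p. 422: FOUR PIECES OF
# BOOKKEEPING FOR THE KNIT TEST FAMILY — row-wise unitary re-basing under the trace pairings, the weighted Cauchy–Schwarz inequality `|⟨E, Φ⟩₁|² ≤ ‖E‖²_w‖Φ‖²_{w⁻¹}`,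
# the band from below `w(ι)Λ_ι² ≥ b₀`, and the `c_f²L^{−2j}`-weighted energy of the transported tent bumps `Σ_b c_f²(L^{lev b})⁻²·HS((T_θΦ)(b)) ≤ 2(d+1)C_Θ‖Φ‖²`

statement-level skeleton of published theorems with citation tags; proofs where landed; nothing here is a claim about the Yang–Mills mass gap

THE PRINT.  [4] p. 248 (2.147) *«⟨λ, QGQ*λ⟩ ≥ γ₀ Σ_y Λ_y²|λ(y)|²»* for print's composite (knit) averaging `Q` of [B9] (3.115) p. 418 ([5] = Bałaban, *Averaging operations for lattice
gauge theories*, CMP **98** (1985), (15)–(23) pp. 19–21); (2.16)∕(2.20) pp. 225–226 (the band `b₀ ≤ a(y)∕(L^jη)^{d−2}… ≤ b₁` of the averaging weights); [B9] (3.13) p. 393 (the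
transporters `R(·)` of `Q(U)` are conjugations by unitaries), p. 393 (the scalar products).

WHY THIS FILE (cell `pub-ymgap`, node N06, seat `dag-n06-l` = bundle F7 rows 20–21, gen 38; road «P-Q26-knit», pieces 6–7).  Row 26 of the N06 certificate at print's KNIT
averaging pair (`Summit….N06Eq3132FromStateKnitQ.s3132_nu_knit_of_stepS_R`) displays ONE binder `hTt`: a test family `T` with (P′2)ᴷ `(1−ϑ)‖Ψ‖² ≤ Re tr⟨Q(U)(TΨ), Λ⁻¹Ψ⟩`
(`Q = QknitY`) and (P′1)ᴷ `⟨TΨ, Δ_a^Q(U)TΨ⟩ ≤ C‖Ψ‖²`.  The family is n06-i's transported tent bumps `T_θ = tentOp (bumpProfile)` of `B9Eq3132TentOperator`, fed with the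
ROW-REBASED amplitude `Ψ♭(ι) = R(T_ι⁻¹)Ψ(ι)` (`T_ι` the row unit of this seat's `B9Eq3115KnitLetterYRowCloseness`: `Q(U) ≈ R(T_ι)Q_Y(U)` row by row).  THIS FILE supplies
the four letter-free pieces the two estimates need: (§1) conjugating every row by a unitary moves across `⟨·,·⟩₁` as the inverse conjugation and preserves every `⟨·,·⟩_w`-norm;
(§2) `⟨E, Φ⟩₁ = ⟨E, w⁻¹Φ⟩_w`, hence `⟨E, Φ⟩₁² ≤ ‖E‖²_w·‖Φ‖²_{w⁻¹}` (n06-j's orthonormal chart `realify311`); (§3) the LOWER half of def-Y's global band (2.16) gives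
`b₀ ≤ w(ι)·Λ_ι²`, so `‖Λ⁻¹Ψ‖²_{w⁻¹} ≤ b₀⁻¹‖Ψ‖²`; (§4) in the weight `c_f²(L^{lev b})⁻²` of n06-j's ℓ²-closeness (`B9Thm311PosDefQknitOfRegYP335AtLettersY.trIP_w_QknitY_sub_rebase_le`)
the transported tents have energy `≤ 2(d+1)·C_Θ(d)·‖Φ‖²` — member-uniform, because a tent of the index bond `y` lives on the base block `Bʲ(base y)` (all its bonds have
`lev = j`, `B9Eq3132TentPlaquettes.levV1_eq_of_mem_baseBlk`) and n06-i's homogeneity `B9Eq3132TentBumps.massSq_hom` reads exactly `c_f²Λ_y²(Lʲ)⁻²·Σ_b θ_y(b)² ≤ C_Θ`.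

WHAT IS PROVED (sorry-free, 0 `def`).
* §1 `re_trace_R_left` (`Re tr((R(V)X)ᴴY) = Re tr(Xᴴ R(V⁻¹)Y)`), ★ `trIP_one_rowConj_left` (`⟨R_V F, G⟩₁ = ⟨F, R_{V⁻¹} G⟩₁`), ★ `trIP_rowConj_self` (`‖R_V F‖²_w = ‖F‖²_w`),
  `rowConj_lamInv_comm`.
* §2 `trIP_one_eq_trIP_w_winv`, `trIP_winv_self`, `trIP_sq_le` (Cauchy–Schwarz for `⟨·,·⟩_w`), ★★ `trIP_one_sq_le_w_winv` (`⟨E,Φ⟩₁² ≤ ‖E‖²_w‖Φ‖²_{w⁻¹}`),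
  `abs_trIP_one_le_of_sq` (its square-root-free consumer form), `trIP_one_add_left`, `trIP_add_self_le` (`‖X+Y‖²_w ≤ 2‖X‖²_w + 2‖Y‖²_w`).
* §3 `b0_le_w_mul_lamY_sq` (`b₀ ≤ w(ι)Λ_ι²`), ★ `trIP_winv_lamInv_le` (`‖Λ⁻¹Ψ‖²_{w⁻¹} ≤ b₀⁻¹‖Ψ‖²`, `b₀ > 0`).
* §4 `sum_wgt_tentField_le` (one tent), ★★ `sum_wgt_hs_tentOp_le` (`Σ_b c_f²(L^{lev b})⁻²HS((T_θΦ)(b)) ≤ 2(d+1)C_Θ(d)·⟨Φ,Φ⟩₁` at every unitary-valued `U`).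

HONEST SCOPE.  Finite-dimensional bookkeeping over def-Y's letters, r03's weights and n06-i's tents; no estimate of [B9] asserted; count-neutral; row 26 ∕ N06 NOT discharged;
nothing continuum ∕ OS ∕ mass gap ∕ Clay.  NEW file; nothing landed is modified.  No `sorry`, no `axiom`, no `instance`, no `notation`, no `def`.
-/

noncomputable section

namespace Literature.MathematicalPhysics.QuantumFieldTheory.Balaban1983to89.B9Eq3132KnitTentRebase

open Node00
open B6KLevelCensusIndexV1 (KIdx)
open B6Ineq2142KLevelV1 (lvl)
open B9Thm311ReadingCoords (trIP trIP_eq_re_trace realify311 inner_realify311 norm_sq_realify311)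
open B9Thm311DeltaPrimeSymm (conjTranspose_R)
open B9Thm311DeltaPrimePos (trIP_self_nonneg trIP_add_right)
open B9Eq3132CoerciveVariational (trIP_comm)
open B9Thm311FlippedBondForms (trIP_self_eq_sum)
open B9Thm311FlippedBondLetters (hs_real_smul)
open B9Ineq369CurvatureSmallAtLettersY (hs_nonneg trIP_one_self_eq)
open B9Ineq369CurvatureSmallAtLettersY (hs_R_le)
open B9Eq3132TentKinetic (contractive_of_mem)
open B9Eq39Adjoint (R R_smul R_inv_R R_R_inv trace_R_mul)
open B9Eq3132NuReading (lamY lamY_pos lamInvY lamInvY_pos)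
open B9Eq3132TentOperator (tentOp)
open B9Eq3132TentCurl (tentField)
open B9Eq3132ApproxRightInverse (bumpProfile bumpProfile_nonneg wt_eq_lamY_sq)
open B9Eq3132TentBumps (baseBlk orgY sideY sideY_pos bumpProfile_src_mem massSq_hom Cth)
open B9Eq3132TentFlat (massSq massSq_nonneg)
open B9Eq3132TentOverlap (hs_tentOp_le)
open B9Eq3132TentKinetic (hs_tentField_le)
open B9Eq3132TentPlaquettes (levV1_eq_of_mem_baseBlk)
open B9BackgroundsKLevelV1 (levV1)
open B6Prop27KLevelV1 (wt)
open scoped Matrix Matrix.Norms.L2Operator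

variable {N : ℕ}

/-! ## §1 Row-wise unitary re-basing under the trace pairings -/

section RowConj

variable {S : Type} [Fintype S]

/-- one point: `Re tr((R(V)X)ᴴ Y) = Re tr(Xᴴ R(V⁻¹) Y)` for unitary `V` (trace cyclicity). [cite: Balaban1985BackgroundPropagators, (3.3) p.390, p.393 (scalar products), bookkeeping] -/
theorem re_trace_R_left (V : (Matrix (Fin N) (Fin N) ℂ)ˣ) (hV : (V : Matrix (Fin N) (Fin N) ℂ) ∈ unitary (Matrix (Fin N) (Fin N) ℂ)) (X Y : Matrix (Fin N) (Fin N) ℂ) :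
    (Matrix.trace ((R V X)ᴴ * Y)).re = (Matrix.trace (Xᴴ * R V⁻¹ Y)).re := by
  have h := trace_R_mul (Matrix.traceLinearMap (Fin N) ℂ ℂ) (fun a b => Matrix.trace_mul_comm a b) V Xᴴ Y
  simp only [Matrix.traceLinearMap_apply] at h
  rw [conjTranspose_R V hV, h]

/-- ★ **ROW CONJUGATION MOVES ACROSS `⟨·,·⟩₁` AS THE INVERSE CONJUGATION**: `⟨(R(V_s)F(s))_s, G⟩₁ = ⟨F, (R(V_s⁻¹)G(s))_s⟩₁` for unitary row units `V_s`.
[cite: Balaban1985BackgroundPropagators, p.393 (scalar products), (3.3) p.390] -/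
theorem trIP_one_rowConj_left (V : S → (Matrix (Fin N) (Fin N) ℂ)ˣ) (hV : ∀ s, (V s : Matrix (Fin N) (Fin N) ℂ) ∈ unitary (Matrix (Fin N) (Fin N) ℂ))
    (F G : S → Matrix (Fin N) (Fin N) ℂ) :
    trIP (fun _ => (1 : ℝ)) (fun s => R (V s) (F s)) G = trIP (fun _ => (1 : ℝ)) F (fun s => R (V s)⁻¹ (G s)) := by
  rw [trIP_eq_re_trace, trIP_eq_re_trace]
  exact Finset.sum_congr rfl fun s _ => by rw [re_trace_R_left (V s) (hV s)]

/-- ★ **ROW CONJUGATION BY UNITARIES PRESERVES EVERY `w`-NORM**: `‖(R(V_s)F(s))_s‖²_w = ‖F‖²_w`. [cite: Balaban1985BackgroundPropagators, p.393 (scalar products), (3.31)–(3.32) p.395] -/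
theorem trIP_rowConj_self (w : S → ℝ) (V : S → (Matrix (Fin N) (Fin N) ℂ)ˣ) (hV : ∀ s, V s ∈ B7Prop2Explicit.unitaryUnits (Matrix (Fin N) (Fin N) ℂ))
    (F : S → Matrix (Fin N) (Fin N) ℂ) :
    trIP w (fun s => R (V s) (F s)) (fun s => R (V s) (F s)) = trIP w F F := by
  rw [trIP_self_eq_sum, trIP_self_eq_sum]
  refine Finset.sum_congr rfl fun s _ => ?_
  congr 1
  have hc := contractive_of_mem (hV s)
  refine le_antisymm (hs_R_le hc (F s)) ?_
  have hc' : ‖(((V s)⁻¹ : (Matrix (Fin N) (Fin N) ℂ)ˣ) : Matrix (Fin N) (Fin N) ℂ)‖ ≤ 1 ∧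
      ‖((((V s)⁻¹)⁻¹ : (Matrix (Fin N) (Fin N) ℂ)ˣ) : Matrix (Fin N) (Fin N) ℂ)‖ ≤ 1 := by rw [inv_inv]; exact ⟨hc.2, hc.1⟩
  have h := hs_R_le hc' (R (V s) (F s))
  rwa [R_inv_R] at h

omit [Fintype S] in
/-- conjugating back: `R(V_s)(R(V_s⁻¹)X) = X`, row by row. [cite: Balaban1985BackgroundPropagators, (3.3) p.390, bookkeeping] -/
theorem rowConj_rowConj_inv (V : S → (Matrix (Fin N) (Fin N) ℂ)ˣ) (G : S → Matrix (Fin N) (Fin N) ℂ) :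
    (fun s => R (V s) (R (V s)⁻¹ (G s))) = G := funext fun s => R_R_inv (V s) (G s)

omit [Fintype S] in
/-- row conjugation commutes with the real row scalars `Λ_s⁻¹`. [cite: Balaban1984PropagatorsII, (2.147) p.248, bookkeeping] -/
theorem rowConj_real_smul (V : S → (Matrix (Fin N) (Fin N) ℂ)ˣ) (c : S → ℝ) (G : S → Matrix (Fin N) (Fin N) ℂ) :
    (fun s => R (V s) (c s • G s)) = fun s => c s • R (V s) (G s) := funext fun s => R_smul (V s) (c s) (G s)

end RowConj

/-! ## §2 The weighted Cauchy–Schwarz inequality `⟨E, Φ⟩₁² ≤ ‖E‖²_w‖Φ‖²_{w⁻¹}` -/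

section WeightedCS

variable {S : Type} [Fintype S]

/-- `⟨E, Φ⟩₁ = ⟨E, w⁻¹Φ⟩_w` for a non-vanishing weight. [cite: Balaban1985BackgroundPropagators, p.393 (scalar products), bookkeeping] -/
theorem trIP_one_eq_trIP_w_winv (w : S → ℝ) (hw : ∀ s, 0 < w s) (E Φ : S → Matrix (Fin N) (Fin N) ℂ) :
    trIP (fun _ => (1 : ℝ)) E Φ = trIP w E (fun s => (w s)⁻¹ • Φ s) := by
  rw [trIP_eq_re_trace, trIP_eq_re_trace]
  refine Finset.sum_congr rfl fun s _ => ?_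
  rw [Matrix.mul_smul, Matrix.trace_smul, Complex.smul_re, smul_eq_mul, one_mul, ← mul_assoc, mul_inv_cancel₀ (hw s).ne', one_mul]

/-- `‖w⁻¹Φ‖²_w = ‖Φ‖²_{w⁻¹}`. [cite: Balaban1985BackgroundPropagators, p.393 (scalar products), bookkeeping] -/
theorem trIP_winv_self (w : S → ℝ) (hw : ∀ s, 0 < w s) (Φ : S → Matrix (Fin N) (Fin N) ℂ) :
    trIP w (fun s => (w s)⁻¹ • Φ s) (fun s => (w s)⁻¹ • Φ s) = trIP (fun s => (w s)⁻¹) Φ Φ := by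
  rw [trIP_self_eq_sum, trIP_self_eq_sum]
  refine Finset.sum_congr rfl fun s _ => ?_
  rw [← Complex.coe_smul, hs_real_smul, ← mul_assoc]
  congr 1
  have h := (hw s).ne'
  field_simp

/-- **CAUCHY–SCHWARZ FOR `⟨·,·⟩_w`** (`w > 0`): `⟨X, Y⟩_w² ≤ ‖X‖²_w‖Y‖²_w` (n06-j's orthonormal chart). [cite: Balaban1985BackgroundPropagators, p.393 (scalar products), bookkeeping] -/
theorem trIP_sq_le (w : S → ℝ) (hw : ∀ s, 0 < w s) (X Y : S → Matrix (Fin N) (Fin N) ℂ) : trIP w X Y ^ 2 ≤ trIP w X X * trIP w Y Y := by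
  rw [← inner_realify311 (w := w) (hw := hw), ← norm_sq_realify311 (w := w) (hw := hw), ← norm_sq_realify311 (w := w) (hw := hw)]
  have h := abs_real_inner_le_norm (realify311 w hw X) (realify311 w hw Y)
  have h0 : 0 ≤ ‖realify311 w hw X‖ * ‖realify311 w hw Y‖ := by positivity
  calc inner ℝ (realify311 w hw X) (realify311 w hw Y) ^ 2 = |inner ℝ (realify311 w hw X) (realify311 w hw Y)| ^ 2 := (sq_abs _).symm
    _ ≤ (‖realify311 w hw X‖ * ‖realify311 w hw Y‖) ^ 2 := pow_le_pow_left₀ (abs_nonneg _) h 2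
    _ = ‖realify311 w hw X‖ ^ 2 * ‖realify311 w hw Y‖ ^ 2 := by ring

/-- ★★ **THE WEIGHTED CAUCHY–SCHWARZ INEQUALITY**: `⟨E, Φ⟩₁² ≤ ‖E‖²_w · ‖Φ‖²_{w⁻¹}` (`w > 0`). [cite: Balaban1985BackgroundPropagators, p.393 (scalar products); Balaban1984PropagatorsII, (2.147) p.248, bookkeeping] -/
theorem trIP_one_sq_le_w_winv (w : S → ℝ) (hw : ∀ s, 0 < w s) (E Φ : S → Matrix (Fin N) (Fin N) ℂ) :
    trIP (fun _ => (1 : ℝ)) E Φ ^ 2 ≤ trIP w E E * trIP (fun s => (w s)⁻¹) Φ Φ := by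
  rw [trIP_one_eq_trIP_w_winv w hw, ← trIP_winv_self w hw]
  exact trIP_sq_le w hw _ _

/-- `|⟨E, Φ⟩₁| ≤ κ·n` as soon as `‖E‖²_w ≤ e·n`, `‖Φ‖²_{w⁻¹} ≤ p·n` and `e·p ≤ κ²` (`n, κ ≥ 0`) — the square-root-free form in which the knit error term is consumed.
[cite: Balaban1984PropagatorsII, (2.147) p.248, bookkeeping] -/
theorem abs_trIP_one_le_of_sq (w : S → ℝ) (hw : ∀ s, 0 < w s) (E Φ : S → Matrix (Fin N) (Fin N) ℂ) {e p κ n : ℝ} (hn : 0 ≤ n) (hκ : 0 ≤ κ)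
    (hE : trIP w E E ≤ e * n) (hΦ : trIP (fun s => (w s)⁻¹) Φ Φ ≤ p * n) (hep : e * p ≤ κ ^ 2) :
    |trIP (fun _ => (1 : ℝ)) E Φ| ≤ κ * n := by
  have h1 := trIP_one_sq_le_w_winv w hw E Φ
  have hE0 : 0 ≤ trIP w E E := trIP_self_nonneg _ hw E
  have hΦ0 : 0 ≤ trIP (fun s => (w s)⁻¹) Φ Φ := trIP_self_nonneg _ (fun s => inv_pos.2 (hw s)) Φ
  have h2 : trIP w E E * trIP (fun s => (w s)⁻¹) Φ Φ ≤ (e * n) * (p * n) := mul_le_mul hE hΦ hΦ0 (hE0.trans hE)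
  have h3 : (e * n) * (p * n) ≤ (κ * n) ^ 2 := by
    have := mul_le_mul_of_nonneg_right hep (mul_nonneg hn hn)
    nlinarith
  exact abs_le_of_sq_le_sq (h1.trans (h2.trans h3)) (mul_nonneg hκ hn)

/-- the weight-one pairing is additive on the left. [cite: Balaban1985BackgroundPropagators, p.393 (scalar products), bookkeeping] -/
theorem trIP_one_add_left (X Y Φ : S → Matrix (Fin N) (Fin N) ℂ) :
    trIP (fun _ => (1 : ℝ)) (X + Y) Φ = trIP (fun _ => (1 : ℝ)) X Φ + trIP (fun _ => (1 : ℝ)) Y Φ := by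
  rw [trIP_comm, trIP_add_right, trIP_comm Φ X, trIP_comm Φ Y]

/-- `‖X + Y‖²_w ≤ 2‖X‖²_w + 2‖Y‖²_w` (`w > 0`). [cite: Balaban1985BackgroundPropagators, p.393 (scalar products), bookkeeping] -/
theorem trIP_add_self_le (w : S → ℝ) (hw : ∀ s, 0 < w s) (X Y : S → Matrix (Fin N) (Fin N) ℂ) :
    trIP w (X + Y) (X + Y) ≤ 2 * trIP w X X + 2 * trIP w Y Y := by
  rw [← norm_sq_realify311 (w := w) (hw := hw), ← norm_sq_realify311 (w := w) (hw := hw), ← norm_sq_realify311 (w := w) (hw := hw), map_add]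
  nlinarith [norm_add_le (realify311 w hw X) (realify311 w hw Y), norm_nonneg (realify311 w hw X), norm_nonneg (realify311 w hw Y),
    norm_nonneg (realify311 w hw X + realify311 w hw Y), sq_nonneg (‖realify311 w hw X‖ - ‖realify311 w hw Y‖)]

end WeightedCS

/-! ## §3 The band from below: `b₀ ≤ w(ι)Λ_ι²`, hence `‖Λ⁻¹Ψ‖²_{w⁻¹} ≤ b₀⁻¹‖Ψ‖²` -/

section Band

variable {d ℓ : ℕ} {hd : 1 ≤ d + 1} {hL : Odd (ℓ + 1) ∧ 1 < ℓ + 1} {b₀ b₁ : ℝ} (i : KIdx d ℓ hd hL b₀ b₁)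

/-- ★ **THE BAND FROM BELOW**: `b₀ ≤ w(ι)·Λ_ι²` — the lower half of def-Y's global band (2.16) `b₀·vol ≤ w(ι)∕(c_f∕Lʲ)²` against `Λ_ι² = (Lʲ∕c_f)²·vol⁻¹`.
[cite: Balaban1984PropagatorsII, (2.16) p.225, (2.81) p.237, (2.142) p.248] -/
theorem b0_le_w_mul_lamY_sq (ι : IBondY i) : b₀ ≤ i.w ι * lamY i ι ^ 2 := by
  have hb := (i.hwb ι).1
  have hcf : i.cf ≠ 0 := i.hcf
  have hLj : (0 : ℝ) < (((ℓ + 1 : ℕ) : ℝ)) ^ (ι.1.1 : ℕ) := by positivity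
  have hq : (0 : ℝ) < (i.cf / (((ℓ + 1 : ℕ) : ℝ)) ^ (ι.1.1 : ℕ)) ^ 2 := by
    have : i.cf / (((ℓ + 1 : ℕ) : ℝ)) ^ (ι.1.1 : ℕ) ≠ 0 := div_ne_zero hcf hLj.ne'
    positivity
  have hvol : (0 : ℝ) < ((((ℓ + 1 : ℕ) : ℝ)) ^ (ι.1.1 : ℕ)) ^ (d + 1) := by positivity
  rw [le_div_iff₀ hq] at hb
  have e : i.w ι * lamY i ι ^ 2 = i.w ι / ((i.cf / (((ℓ + 1 : ℕ) : ℝ)) ^ (ι.1.1 : ℕ)) ^ 2 * ((((ℓ + 1 : ℕ) : ℝ)) ^ (ι.1.1 : ℕ)) ^ (d + 1)) := by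
    rw [← wt_eq_lamY_sq, wt]
    unfold lvl
    rw [← pow_mul, ← pow_mul, mul_comm (d + 1)]
    field_simp
  rw [e, le_div_iff₀ (mul_pos hq hvol)]
  calc b₀ * ((i.cf / (((ℓ + 1 : ℕ) : ℝ)) ^ (ι.1.1 : ℕ)) ^ 2 * ((((ℓ + 1 : ℕ) : ℝ)) ^ (ι.1.1 : ℕ)) ^ (d + 1))
      = b₀ * ((((ℓ + 1 : ℕ) : ℝ)) ^ (ι.1.1 : ℕ)) ^ (d + 1) * (i.cf / (((ℓ + 1 : ℕ) : ℝ)) ^ (ι.1.1 : ℕ)) ^ 2 := by ring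
    _ ≤ i.w ι := hb

/-- ★ **`‖Λ⁻¹Ψ‖²_{w⁻¹} ≤ b₀⁻¹·‖Ψ‖²`** (`b₀ > 0`). [cite: Balaban1984PropagatorsII, (2.16) p.225, (2.147) p.248] -/
theorem trIP_winv_lamInv_le (hb₀ : 0 < b₀) (Ψ : IBondY i → Matrix (Fin N) (Fin N) ℂ) :
    trIP (fun ι => (i.w ι)⁻¹) (fun ι => lamInvY i ι • Ψ ι) (fun ι => lamInvY i ι • Ψ ι) ≤ b₀⁻¹ * trIP (fun _ => (1 : ℝ)) Ψ Ψ := by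
  rw [trIP_self_eq_sum, trIP_one_self_eq, Finset.mul_sum]
  refine Finset.sum_le_sum fun ι _ => ?_
  rw [← Complex.coe_smul, hs_real_smul, ← mul_assoc]
  refine mul_le_mul_of_nonneg_right ?_ (hs_nonneg _)
  have hw := i.hw ι
  have hΛ := lamY_pos i ι
  have hband := b0_le_w_mul_lamY_sq i ι
  rw [lamInvY, inv_pow, ← mul_inv, inv_le_inv₀ (mul_pos hw (pow_pos hΛ 2)) hb₀]
  exact hband

end Band

/-! ## §4 The `c_f²(L^{lev b})⁻²`-weighted energy of the transported tent bumps -/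

section TentWeight

variable {d ℓ : ℕ} {hd : 1 ≤ d + 1} {hL : Odd (ℓ + 1) ∧ 1 < ℓ + 1} {b₀ b₁ : ℝ} (i : KIdx d ℓ hd hL b₀ b₁)
variable {U : CfgY (Matrix (Fin N) (Fin N) ℂ) i} (hU : ∀ μ x, U μ x ∈ B7Prop2Explicit.unitaryUnits (Matrix (Fin N) (Fin N) ℂ))
include hU

/-- **ONE TENT** in the weight `c_f²(L^{lev b})⁻²`: `Σ_b c_f²(L^{lev b})⁻²·HS(tent_y(b)) ≤ c_f²(Lʲ)⁻²Λ_y²·massSq(θ_y)·HS(Φ(y)) ≤ C_Θ(d)·HS(Φ(y))` — every bond of the tent of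
`y` issues from the base block `Bʲ(base y)`, where `lev = j`. [cite: Balaban1984PropagatorsII, (2.147) p.248, (2.3)–(2.4) p.224; Balaban1985BackgroundPropagators, (3.13) p.393] -/
theorem sum_wgt_tentField_le (Φ : IBondY i → Matrix (Fin N) (Fin N) ℂ) (y : IBondY i) :
    ∑ b : FBondY i, (i.cf ^ 2 * ((((ℓ : ℝ) + 1) ^ levV1 i b.src)⁻¹) ^ 2) * ∑ a, ∑ c, ‖tentField i (bumpProfile i y) (orgY i y) U (lamY i y • Φ y) b a c‖ ^ 2
      ≤ Cth d * ∑ a, ∑ c, ‖Φ y a c‖ ^ 2 := by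
  have hL : (((ℓ + 1 : ℕ) : ℝ)) = (ℓ : ℝ) + 1 := by push_cast; ring
  -- termwise: either `θ_y(b) = 0`, or `lev b = j` and the weight is `c_f²(Lʲ)⁻²`
  have hterm : ∀ b : FBondY i,
      (i.cf ^ 2 * ((((ℓ : ℝ) + 1) ^ levV1 i b.src)⁻¹) ^ 2) * ∑ a, ∑ c, ‖tentField i (bumpProfile i y) (orgY i y) U (lamY i y • Φ y) b a c‖ ^ 2
        ≤ (i.cf ^ 2 * (sideY i y)⁻¹ ^ 2) * (bumpProfile i y b ^ 2 * (lamY i y ^ 2 * ∑ a, ∑ c, ‖Φ y a c‖ ^ 2)) := by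
    intro b
    have h1 := hs_tentField_le i hU (bumpProfile i y) (orgY i y) (lamY i y • Φ y) b
    have hlam : ∑ a, ∑ c, ‖(lamY i y • Φ y) a c‖ ^ 2 = lamY i y ^ 2 * ∑ a, ∑ c, ‖Φ y a c‖ ^ 2 := by rw [← Complex.coe_smul, hs_real_smul]
    rw [hlam] at h1
    by_cases hθ : bumpProfile i y b = 0
    · have h0 : tentField i (bumpProfile i y) (orgY i y) U (lamY i y • Φ y) b = 0 := by rw [tentField, hθ, Complex.ofReal_zero, zero_smul]
      rw [h0, hθ]
      simp
    · have hlev : levV1 i b.src = lvl i.hN i.D i.hk y := levV1_eq_of_mem_baseBlk i y (bumpProfile_src_mem i y hθ).2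
      have hw : (i.cf ^ 2 * ((((ℓ : ℝ) + 1) ^ levV1 i b.src)⁻¹) ^ 2) = i.cf ^ 2 * (sideY i y)⁻¹ ^ 2 := by rw [hlev, sideY, hL]
      rw [hw]
      exact mul_le_mul_of_nonneg_left h1 (by positivity)
  refine (Finset.sum_le_sum fun b _ => hterm b).trans ?_
  rw [← Finset.mul_sum, ← Finset.sum_mul]
  have hm := massSq_hom i y
  have hΦ := hs_nonneg (Φ y)
  have e : i.cf ^ 2 * (sideY i y)⁻¹ ^ 2 * ((∑ b, bumpProfile i y b ^ 2) * (lamY i y ^ 2 * ∑ a, ∑ c, ‖Φ y a c‖ ^ 2))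
      = (i.cf ^ 2 * lamY i y ^ 2 * (sideY i y)⁻¹ ^ 2 * massSq i (bumpProfile i y)) * ∑ a, ∑ c, ‖Φ y a c‖ ^ 2 := by
    rw [massSq]; ring
  rw [e]
  exact mul_le_mul_of_nonneg_right hm hΦ

/-- ★★ **THE `c_f²(L^{lev b})⁻²`-WEIGHTED ENERGY OF THE TRANSPORTED TENTS IS MEMBER-UNIFORM**: at every unitary-valued `U`,
`Σ_b c_f²(L^{lev b})⁻²·HS((T_θΦ)(b)) ≤ 2(d+1)·C_Θ(d)·⟨Φ, Φ⟩₁` (`T_θ = tentOp (bumpProfile)`; at most `2(d+1)` tents on a bond, `B9Eq3132TentOverlap.hs_tentOp_le`).  This is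
the weight of n06-j's ℓ²-closeness of `Q(U)` to the rebased `Q_Y(U)`; so the knit error terms of (P′2)ᴷ∕(P′1)ᴷ cost `δ²·2(d+1)C_Θ·‖Φ‖²`, no `c_f²` left over.
[cite: Balaban1984PropagatorsII, (2.147) p.248, (2.45) p.231; Balaban1985BackgroundPropagators, (3.13) p.393, (3.115) p.418] -/
theorem sum_wgt_hs_tentOp_le (Φ : IBondY i → Matrix (Fin N) (Fin N) ℂ) :
    ∑ b : FBondY i, (i.cf ^ 2 * ((((ℓ : ℝ) + 1) ^ levV1 i b.src)⁻¹) ^ 2) * ∑ a, ∑ c, ‖tentOp i (bumpProfile i) U Φ b a c‖ ^ 2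
      ≤ 2 * ((d : ℝ) + 1) * Cth d * trIP (fun _ => (1 : ℝ)) Φ Φ := by
  have step : ∀ b : FBondY i,
      (i.cf ^ 2 * ((((ℓ : ℝ) + 1) ^ levV1 i b.src)⁻¹) ^ 2) * ∑ a, ∑ c, ‖tentOp i (bumpProfile i) U Φ b a c‖ ^ 2
        ≤ (2 * ((d : ℝ) + 1)) * ∑ y, (i.cf ^ 2 * ((((ℓ : ℝ) + 1) ^ levV1 i b.src)⁻¹) ^ 2) *
            ∑ a, ∑ c, ‖tentField i (bumpProfile i y) (orgY i y) U (lamY i y • Φ y) b a c‖ ^ 2 := by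
    intro b
    have h := hs_tentOp_le i (U := U) Φ b
    calc _ ≤ (i.cf ^ 2 * ((((ℓ : ℝ) + 1) ^ levV1 i b.src)⁻¹) ^ 2) *
          ((2 * ((d : ℝ) + 1)) * ∑ y, ∑ a, ∑ c, ‖tentField i (bumpProfile i y) (orgY i y) U (lamY i y • Φ y) b a c‖ ^ 2) :=
            mul_le_mul_of_nonneg_left h (by positivity)
      _ = _ := by rw [Finset.mul_sum, Finset.mul_sum, Finset.mul_sum]; exact Finset.sum_congr rfl fun y _ => by ring
  refine (Finset.sum_le_sum fun b _ => step b).trans ?_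
  rw [← Finset.mul_sum, Finset.sum_comm, trIP_one_self_eq, mul_assoc (2 * ((d : ℝ) + 1)), Finset.mul_sum Finset.univ (fun y => ∑ a, ∑ c, ‖Φ y a c‖ ^ 2)]
  exact mul_le_mul_of_nonneg_left (Finset.sum_le_sum fun y _ => sum_wgt_tentField_le i hU Φ y) (by positivity)

end TentWeight

end Literature.MathematicalPhysics.QuantumFieldTheory.Balaban1983to89.B9Eq3132KnitTentRebase

end
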